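import Summits.ValiantsHypothesis.ValiantsHypothesis.Theorems.LaplaceOptimalFive.Negative.SignPatternCheap
import Summits.ValiantsHypothesis.ValiantsHypothesis.Theorems.RigidityForcesSymmetryRankRigidMinimalReprLaplaceFiveWeight72

/-!
# Barrier (internal, PROVED): SIGN-BLIND Laplace-weight arguments stop at `72` for `d = 5`
# (Negative lane of stmt-ValiantsHypothesis-24813 `LaplaceOptimalFive`; director-valiant R274 (2)(a); val-neg-2 g2)

A D-0021-style barrier entry, filed under the summit because it is a NEW (unpublished) statement proved from tree theorems
(the gate keeps `Literature/Barriers/` for printed statements).  Route decl concerned: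
`Summit.ValiantsHypothesis.ValiantsHypothesis.Theses.RigidityForcesSymmetry.LaplaceOptimalFive` = `LaplaceOptimal 5`
(every family of split-rank-one terms `u_t(v|_{S_t}) · w_t(v|_{S_tᶜ})` summing to `P₅(v) = [v injective]` on `Fin 5 → Fin 5`
has Laplace weight `Σ_t |S_t|!·(5−|S_t|)! ≥ 120`).

**Sign-blind validity** (technique class, written INLINE in every statement below — no new definitions): a bound `B` is
sign-blindly valid at size `d` if it holds for every exact split-rank-one decomposition of EVERY `±1`-rescaling
`v ↦ ε(v)·[v injective]` of the permutation pattern (`ε` prescribed on the injective words; exactness on all words, as in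
`LaplaceOptimal d`).  This is the extensional rendering of "an argument none of whose steps reads the signs of the target" —
in particular one that holds verbatim for the determinant pattern `D₅ = sgn·[injective]`.

**Results.**
* `signBlind_le_72`: a sign-blindly valid bound at `d = 5` is `≤ 72` — instantiate at `ε = sgn` and at the weight-`72`
  decomposition of `D₅` (`SignPatternCheap.sign_five_cheap`, ✓ p646934: one slice `{0}` + the four hub pairs `{0,j}`,
  `0/±1` coefficients).
* `not_signBlind_120`: NO sign-blind argument proves `LaplaceOptimalFive`.
* `signBlind_frontier_five`: the rung of record `72 ≤ weight(P₅)` (`LaplaceFivePairCore.laplace_five_weight_ge_72`, ✓ p633018)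
  is the sign-blind ceiling: every rung `> 72` toward `120` needs a SIGN-SENSITIVE step (a property of `P₅` false for `D₅`).

BARRIER (catalogue fields, for planners)
technique_class: sign-blind-laplace-weight, support-tiling-counts, per-split-flattening-rank, one-slot-restriction-recursion,
  arguments-valid-for-the-determinant-pattern
blocks: every proof of `LaplaceOptimalFive` (weight `≥ 120`) — and every rung `> 72` — by an argument whose steps hold for all
  `±1`-rescalings of `P₅` (in particular for `D₅`): it would certify a sign-blindly valid `B > 72`, contradicting `signBlind_le_72`.
because: `D₅` has a split-rank-one decomposition of weight `72 < 120` (`sign_five_cheap`; `D₄`: `12 < 24`, `sign_four_cheap`;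
  `D₆`: `240 < 720` by the same hub recursion, computed, not formalised).  Printed instance of the phenomenon: partial-derivative /
  coefficient-matrix ranks of `det_n` and `perm_n` coincide (Raz 2009, Thm. 1.1; Landsberg 2017, §6.2.2) — per-split flattening
  ranks of `D_d` and `P_d` coincide likewise (rows agree up to sign).
evasions_known: SIGN-SENSITIVE hypotheses — the on-shell / letter-SET symmetry of the factors (LINE `shallow_collision`, stub
  `stub_onShell_five`; the cheap `D₅` decomposition is antisymmetric in the letters, i.e. OFF-shell), positivity / monotonicity
  of coefficients (Jerrum–Snir 1982 §4.3: the permanental Laplace expansion is monotone-optimal), any use of the VALUES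
  `u_t·w_t` on junk words beyond their supports; at `d = 4` the tree's theorem `LaplaceOptimal 4` (`24` versus `D₄`'s `12`) is a
  worked sign-sensitive argument — the nearest place to read off where sign-sensitivity enters.
scope_caveats: (1) `≤ 72` is a ceiling for sign-blind bounds; whether `72` is ATTAINED sign-blindly (is the slot-contraction
  argument of `laplace_five_weight_ge_72` valid for `D₅`, i.e. weight(`D₅`) `= 72` exactly?) is OPEN here; (2) exact
  decompositions only — border / approximate formats are out of scope (`Negative/LaplaceFiveBorder.lean`); (3) `d = 5` formalised.
status: PROVED (this file) from ✓ `sign_five_cheap` and ✓ `laplace_five_weight_ge_72`.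

HONEST FRAMING: a barrier theorem about a technique class; `LaplaceOptimalFive` (24813) stays OPEN; nothing here bears on
`VP ≠ VNP`, which is NOT proved.
-/

set_option autoImplicit false

-- the mandated summit-side namespace repeats a component by design (single-problem summit)
set_option linter.dupNamespace false

namespace Summit.ValiantsHypothesis.ValiantsHypothesis.Theorems.LaplaceOptimalFiveNegative.SignBlindBarrier

open Finset
open Summit.ValiantsHypothesis.ValiantsHypothesis.Theorems.LaplaceOptimalFiveNegative.SignPatternCheap
  (sign_five_cheap levi_five_eq_zero levi_five_perm)
open Summit.ValiantsHypothesis.ValiantsHypothesis.Theorems.RigidityForcesSymmetryRankRigidMinimalRepr.LaplaceFivePairCore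
  (laplace_five_weight_ge_72)

/-- On the injective words the inline Levi-Civita product of `SignPatternCheap` is `±1` (it is the signature of the
permutation, `levi_five_perm`). -/
theorem levi_five_unit (v : Fin 5 → Fin 5) (hv : Function.Injective v) :
    ((((if v 0 < v 1 then (1:ℤ) else if v 1 < v 0 then (-1:ℤ) else 0) * (if v 0 < v 2 then (1:ℤ) else if v 2 < v 0 then (-1:ℤ) else 0) * (if v 0 < v 3 then (1:ℤ) else if v 3 < v 0 then (-1:ℤ) else 0) * (if v 0 < v 4 then (1:ℤ) else if v 4 < v 0 then (-1:ℤ) else 0) * (if v 1 < v 2 then (1:ℤ) else if v 2 < v 1 then (-1:ℤ) else 0) * (if v 1 < v 3 then (1:ℤ) else if v 3 < v 1 then (-1:ℤ) else 0) * (if v 1 < v 4 then (1:ℤ) else if v 4 < v 1 then (-1:ℤ) else 0) * (if v 2 < v 3 then (1:ℤ) else if v 3 < v 2 then (-1:ℤ) else 0) * (if v 2 < v 4 then (1:ℤ) else if v 4 < v 2 then (-1:ℤ) else 0) * (if v 3 < v 4 then (1:ℤ) else if v 4 < v 3 then (-1:ℤ) else 0)) : ℤ) : ℂ) = 1 ∨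 ((((if v 0 < v 1 then (1:ℤ) else if v 1 < v 0 then (-1:ℤ) else 0) * (if v 0 < v 2 then (1:ℤ) else if v 2 < v 0 then (-1:ℤ) else 0) * (if v 0 < v 3 then (1:ℤ) else if v 3 < v 0 then (-1:ℤ) else 0) * (if v 0 < v 4 then (1:ℤ) else if v 4 < v 0 then (-1:ℤ) else 0) * (if v 1 < v 2 then (1:ℤ) else if v 2 < v 1 then (-1:ℤ) else 0) * (if v 1 < v 3 then (1:ℤ) else if v 3 < v 1 then (-1:ℤ) else 0) * (if v 1 < v 4 then (1:ℤ) else if v 4 < v 1 then (-1:ℤ) else 0) * (if v 2 < v 3 then (1:ℤ) else if v 3 < v 2 then (-1:ℤ) else 0) * (if v 2 < v 4 then (1:ℤ) else if v 4 < v 2 then (-1:ℤ) else 0) * (if v 3 < v 4 then (1:ℤ) else if v 4 < v 3 then (-1:ℤ) else 0)) : ℤ) : ℂ) = -1 := by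
  have hbij : Function.Bijective v := Finite.injective_iff_bijective.mp hv
  have key := levi_five_perm (Equiv.ofBijective v hbij)
  simp only [Equiv.ofBijective_apply] at key
  rcases Int.units_eq_one_or (Equiv.Perm.sign (Equiv.ofBijective v hbij)) with h1 | h1
  · left
    rw [h1, Units.val_one] at key
    exact_mod_cast key
  · right
    rw [h1, Units.val_neg, Units.val_one] at key
    exact_mod_cast key

/-- **The sign-blind ceiling at `d = 5` is `72`.**  If a Laplace-weight lower bound `B` holds for every exact split-rank-one
decomposition of every `±1`-rescaling of the permutation pattern on `Fin 5 → Fin 5` (sign-blind validity, inline), then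
`B ≤ 72` — witnessed by the determinant pattern `ε = sgn` and its weight-`72` decomposition `sign_five_cheap`. -/
theorem signBlind_le_72 {B : ℕ}
    (h : (∀ ε : (Fin 5 → Fin 5) → ℂ, (∀ v, Function.Injective v → (ε v = 1 ∨ ε v = -1)) →
      ∀ (N : ℕ) (T : Finset (Fin N)) (S : Fin N → Finset (Fin 5)) (u w : Fin N → (Fin 5 → Fin 5) → ℂ),
        (∀ t, ∀ v v' : Fin 5 → Fin 5, (∀ i ∈ S t, v i = v' i) → u t v = u t v') →
        (∀ t, ∀ v v' : Fin 5 → Fin 5, (∀ i, i ∉ S t → v i = v' i) → w t v = w t v') →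
        (∀ v : Fin 5 → Fin 5, (∑ t ∈ T, u t v * w t v) = if Function.Injective v then ε v else 0) →
        B ≤ ∑ t ∈ T, (S t).card.factorial * (5 - (S t).card).factorial)) :
    B ≤ 72 := by
  obtain ⟨T, S, u, w, hu, hw, hwt, -, hid⟩ := sign_five_cheap
  have key := h (fun v => (((((if v 0 < v 1 then (1:ℤ) else if v 1 < v 0 then (-1:ℤ) else 0) * (if v 0 < v 2 then (1:ℤ) else if v 2 < v 0 then (-1:ℤ) else 0) * (if v 0 < v 3 then (1:ℤ) else if v 3 < v 0 then (-1:ℤ) else 0) * (if v 0 < v 4 then (1:ℤ) else if v 4 < v 0 then (-1:ℤ) else 0) * (if v 1 < v 2 then (1:ℤ) else if v 2 < v 1 then (-1:ℤ) else 0) * (if v 1 < v 3 then (1:ℤ) else if v 3 < v 1 then (-1:ℤ) else 0) * (if v 1 < v 4 then (1:ℤ) else if v 4 < v 1 then (-1:ℤ) else 0) * (if v 2 < v 3 then (1:ℤ) else if v 3 < v 2 then (-1:ℤ) else 0) * (if v 2 < v 4 then (1:ℤ) else if v 4 < v 2 then (-1:ℤ) else 0) * (if v 3 < v 4 then (1:ℤ)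 else if v 4 < v 3 then (-1:ℤ) else 0)) : ℤ) : ℤ) : ℂ)) (fun v hv => levi_five_unit v hv) 5 T S u w hu hw ?_
  · rwa [hwt] at key
  · intro v
    by_cases hv : Function.Injective v
    · rw [if_pos hv, hid v]
    · rw [if_neg hv, hid v, levi_five_eq_zero v hv]
      simp

/-- **No sign-blind argument proves `LaplaceOptimalFive`** (`B = 5! = 120` is not sign-blindly valid). -/
theorem not_signBlind_120 :
    ¬ (∀ ε : (Fin 5 → Fin 5) → ℂ, (∀ v, Function.Injective v → (ε v = 1 ∨ ε v = -1)) →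
      ∀ (N : ℕ) (T : Finset (Fin N)) (S : Fin N → Finset (Fin 5)) (u w : Fin N → (Fin 5 → Fin 5) → ℂ),
        (∀ t, ∀ v v' : Fin 5 → Fin 5, (∀ i ∈ S t, v i = v' i) → u t v = u t v') →
        (∀ t, ∀ v v' : Fin 5 → Fin 5, (∀ i, i ∉ S t → v i = v' i) → w t v = w t v') →
        (∀ v : Fin 5 → Fin 5, (∑ t ∈ T, u t v * w t v) = if Function.Injective v then ε v else 0) →
        120 ≤ ∑ t ∈ T, (S t).card.factorial * (5 - (S t).card).factorial) :=
  fun h => absurd (signBlind_le_72 h) (by norm_num)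

/-- **The sign-blind ceiling coincides with the rung of record.**  `P₅` needs weight `≥ 72` (`laplace_five_weight_ge_72`,
✓ p633018) and no sign-blindly valid bound exceeds `72`: every rung above `72` toward `LaplaceOptimalFive` must be certified by a
SIGN-SENSITIVE argument (one that fails for `D₅`). -/
theorem signBlind_frontier_five :
    (∀ {N : ℕ} (T : Finset (Fin N)) (S : Fin N → Finset (Fin 5)) (u w : Fin N → (Fin 5 → Fin 5) → ℂ),
      (∀ t, ∀ v v' : Fin 5 → Fin 5, (∀ i ∈ S t, v i = v' i) → u t v = u t v') →
      (∀ t, ∀ v v' : Fin 5 → Fin 5, (∀ i, i ∉ S t → v i = v' i) → w t v = w t v') →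
      (∀ v : Fin 5 → Fin 5, (∑ t ∈ T, u t v * w t v) = if Function.Injective v then 1 else 0) →
      72 ≤ ∑ t ∈ T, (S t).card.factorial * (5 - (S t).card).factorial) ∧
    (∀ B : ℕ, (∀ ε : (Fin 5 → Fin 5) → ℂ, (∀ v, Function.Injective v → (ε v = 1 ∨ ε v = -1)) →
      ∀ (N : ℕ) (T : Finset (Fin N)) (S : Fin N → Finset (Fin 5)) (u w : Fin N → (Fin 5 → Fin 5) → ℂ),
        (∀ t, ∀ v v' : Fin 5 → Fin 5, (∀ i ∈ S t, v i = v' i) → u t v = u t v') →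
        (∀ t, ∀ v v' : Fin 5 → Fin 5, (∀ i, i ∉ S t → v i = v' i) → w t v = w t v') →
        (∀ v : Fin 5 → Fin 5, (∑ t ∈ T, u t v * w t v) = if Function.Injective v then ε v else 0) →
        B ≤ ∑ t ∈ T, (S t).card.factorial * (5 - (S t).card).factorial) → B ≤ 72) :=
  ⟨fun T S u w hu hw hid => laplace_five_weight_ge_72 T S u w hu hw hid, fun _ h => signBlind_le_72 h⟩

/-- A sign-blindly valid bound is in particular a bound for the permutation pattern itself (`ε ≡ 1`, the `LaplaceOptimal 5`
data format) — recorded so that the class visibly CONTAINS the ordinary lower-bound format. -/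
theorem signBlind_perm_pattern {B : ℕ}
    (h : (∀ ε : (Fin 5 → Fin 5) → ℂ, (∀ v, Function.Injective v → (ε v = 1 ∨ ε v = -1)) →
      ∀ (N : ℕ) (T : Finset (Fin N)) (S : Fin N → Finset (Fin 5)) (u w : Fin N → (Fin 5 → Fin 5) → ℂ),
        (∀ t, ∀ v v' : Fin 5 → Fin 5, (∀ i ∈ S t, v i = v' i) → u t v = u t v') →
        (∀ t, ∀ v v' : Fin 5 → Fin 5, (∀ i, i ∉ S t → v i = v' i) → w t v = w t v') →
        (∀ v : Fin 5 → Fin 5, (∑ t ∈ T, u t v * w t v) = if Function.Injective v then ε v else 0) →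
        B ≤ ∑ t ∈ T, (S t).card.factorial * (5 - (S t).card).factorial)) :
    ∀ (N : ℕ) (T : Finset (Fin N)) (S : Fin N → Finset (Fin 5)) (u w : Fin N → (Fin 5 → Fin 5) → ℂ),
      (∀ t, ∀ v v' : Fin 5 → Fin 5, (∀ i ∈ S t, v i = v' i) → u t v = u t v') →
      (∀ t, ∀ v v' : Fin 5 → Fin 5, (∀ i, i ∉ S t → v i = v' i) → w t v = w t v') →
      (∀ v : Fin 5 → Fin 5, (∑ t ∈ T, u t v * w t v) = if Function.Injective v then 1 else 0) →
      B ≤ ∑ t ∈ T, (S t).card.factorial * (5 - (S t).card).factorial :=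
  fun N T S u w hu hw hid => h (fun _ => 1) (fun _ _ => Or.inl rfl) N T S u w hu hw hid

end Summit.ValiantsHypothesis.ValiantsHypothesis.Theorems.LaplaceOptimalFiveNegative.SignBlindBarrier
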